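import Summits.QuantumFields.BalabanUV.Beta.WardLocusRecursiveLettersSlot
import Summits.QuantumFields.BalabanUV.Beta.WardLocusSymSockets
import Summits.QuantumFields.BalabanUV.Beta.KernelWardSymEnd

/-!
# `BalabanUV.Beta.WardLocusSymSecondOrder` — binder row D1, THE SECOND-ORDER WARD KERNEL LAW OF THE (0.4) LITERAL's W-TABLES `WsymOf tabs` AT EVERY
# LEVEL, FROM TABLE LETTERS: the slot-generic chain (`WardLocusRecursiveLettersSlot.exists_kernelLaws_of_letters_slot`) INSTANTIATED at the symmetrised
# resolvents `Gsym`, the shifted straight spread `bhKStepSh d Lc Dsh`, the symmetrised slice projector `symEc Lc` and the table record `SymTables`, with EVERY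
# resolvent socket DISCHARGED BY NAME (β sub-cell, BINDER-OWNERS row D1 OWNER `b2b-balaban-beta-an2`, gen 29; INTENT «SYM-hW-SECOND-ORDER» journal [AN2-G29-ONLINE])

HONEST FRAMING (cell charter, verbatim): «discharging BetaPertH makes Bałaban's UV stability UNCONDITIONAL — a real constructive-QFT result; it is
NOT the continuum limit and NOT the Clay problem.»  HONEST DEPENDENCY: continuum YM on T⁴ ⇐ BetaPertH ∧ nine spine estimates (0/9 proved);
BetaPertH ⇐ (D1) ∧ (D4) ∧ CAP+tail; G-an2-4 gates asym, D1 and NE2/3/4.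
NOT IN PRINT; OUR BOOKKEEPING.  [folklore] instantiation; sockets discharged: (DG) `decays_Gsym`, `Spr (bhKStepSh …)` `SymShiftedSpread.spr_bhKStepSh`, `Spr (symEc Lc)`
`SymSliceProjectorSpread.spr_symEc`, `RelInv (Gsym j) (bhKStepSh Dsh j) (symEc Lc)` `RelInvNullShift.relInv_Gsym_bhKStep_add` ((Dspr)(Dnull)), ℋ-column Ward law
`KernelWardHColumnSym.colH_ward_coDressKSymAt_KInvStep` (`cH j = (stepScale j·Lc^{d+1})⁻¹`), (hMw) `WardLocusSymSockets.colM_Gsym_ward`, (hoff) `Gsym_inr_inr_off`,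
`[symEc, X y] = 0` `SymSliceProjectorDiagComm.comp_symEc_blockGen_comm`, (hD) `WardLocusSymSockets.divV_dM_SpureSymOf_eq_conjV` ((Dspr)(Dnull)(V-d)), sgn-symmetry
`KernelWardSymEnd.trK_coDressKSymAt_KInvStep`, the locks `WardLocusQuarticTable.lock_succ_of_pin` (pin `cE₂ = Lc^{2(d+1)}`).  DISPLAYED HYPOTHESES (letters about
an1's table VALUES, typed nowhere): the shift's (Dspr)(Dnull) and the border letter (V-d) (for an1's `DshAn1.Dsh` theorems ∕ ≡ (S-V)⁰⁴); the ORDER-ONE CONSISTENCY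
(c1) `dM (Gsym j) Lc (SpureSymOf … j) (tabs.M j) = vertexOfK (Gsym j) Lc (SsymOf … j)` (table part: `tabs.M = M1Of tabs.H cΛ` — an1 [AN1-G39-R7] Q-R41-1 (i);
K part: the Lagrange fold for `coDressKSymAt`, the sym twin of leaf-10's `LagrangeFoldLiteral` — NOT yet typed); the ROW PARITIES (Sp) of `SpureSymOf … j` and
(Mp) of `tabs.M j`; the SECOND-ORDER TABLE LETTERS with classified parity-odd remainders: (T2-W) the level-`0` Wilson Ward law of `cE₂ • wilsonW₂ d T` both slots,
(T2-B) the border Ward law of `tabs.vh₂S` against `tabs.V` both slots every level, (T2-M₂) the mixed Ward law of `M2Of tabs.mixFF j` against `tabs.M j` every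
level.  No statement of Bałaban's papers, no `[cite:]`, no `def`, no `def … : Prop`; instantiates NO binder of the β-function wall.  The second-order hW letter (Wd)
of the literal is REDUCED TO TABLE LETTERS here, NOT discharged; root-level classes 0∕5; tables 0∕5; NOT D1, NOT `BetaPertH`, NOT continuum, NOT Clay.

* §1 **`exists_kernelLaws_WsymOf_of_letters`** (generic `d`, pins `(cE, cVH) = (Lc^{d+1}, −Lc^{d+1}·½·Lc^{d+1})`, `cE₂ = Lc^{2(d+1)}`, any `cΛ cB T`): there is a
  residual family `Nr` — uniformly classified, row-parity-odd — with
  `∀ j y ν y′, divW (WsymOf tabs … j) y ν y′ = conjV (dM (Gsym Lc j) Lc (SpureSymOf tabs … j) (tabs.M j) ν y′) (diagK (½ • Σ_v legInd ρ_c (Lc•y+v))) + Nr j y ν y′`.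
Provenance: β sub-cell, unit beta-an2 gen 29, 2026-08-21 (v1); over the slot-generic chain and the socket files named above BY NAME; no existing file touched.
-/

noncomputable section

open Finset
open scoped BigOperators
open Literature.MathematicalPhysics.QuantumFieldTheory
open Literature.MathematicalPhysics.QuantumFieldTheory.Balaban1983to89
open Literature.MathematicalPhysics.QuantumFieldTheory.Balaban1983to89.Beta
open B6BondElimination (unitVec)
open ExpKernelCalculus (MKer Decays BiLoc VertexFamily VertexFamily₂ comp)
open KernelWard (divV divW)
open AffineAveraging (Site box toSite)
open AveragingContoursRooted (ctr ctrOff ctrOff_mem_box)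
open OneStepResolventKernel (Fib wsum LocStencil)
open OneStepKernelFamily (KInvStep colH vertexOfK)
open InterLevelTransport (cwsum)
open BalabanStepJetsSucc (mmRead wE wVH)
open SecondOrderResponse (colM vertexOfM dM LocStencilFM)
open BalabanCompositeJets (LocStencil₂)
open BalabanStepW2 (M2Of wV4 wB2)
open StepJetData (wilsonA)
open WilsonBiStencil (wilsonW₂)
open Summit.QuantumFields.BalabanUV.Beta.TameKernelCalculus
open Summit.QuantumFields.BalabanUV.Beta.ChartConjugation (conjV)
open Summit.QuantumFields.BalabanUV.Beta.ChartConjugationRelative (RelInv)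
open Summit.QuantumFields.BalabanUV.Beta.AxialDressingRooted (one_le_of_neZero)
open Summit.QuantumFields.BalabanUV.Beta.BorderedHessian (bhK stepScale diagK sgnK)
open Summit.QuantumFields.BalabanUV.Beta.AveragingWardRootedStencils (legInd)
open Summit.QuantumFields.BalabanUV.Beta.WardLocusStencils (ffK)
open Summit.QuantumFields.BalabanUV.Beta.KernelWardRelative (gaugeWt)
open Summit.QuantumFields.BalabanUV.Beta.SymSliceProjectorKernel (symEc)
open Summit.QuantumFields.BalabanUV.Beta.SymSliceProjectorSpread (spr_symEc)
open Summit.QuantumFields.BalabanUV.Beta.SymSliceProjectorDiagComm (comp_symEc_blockGen_comm)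
open Summit.QuantumFields.BalabanUV.Beta.KernelWardHColumnSym (colH_ward_coDressKSymAt_KInvStep)
open Summit.QuantumFields.BalabanUV.Beta.KernelWardSymEnd (trK_coDressKSymAt_KInvStep)
open Summit.QuantumFields.BalabanUV.Beta.SymmetrisedStepJets (SymTables Gsym Gsym_apply decays_Gsym SsymOf SsymOf_eq SpureSymOf WsymOf WsymOf_eq)
open Summit.QuantumFields.BalabanUV.Beta.RelInvNullShift (relInv_Gsym_bhKStep_add)
open Summit.QuantumFields.BalabanUV.Beta.SymShiftedSpread (bhKStepSh spr_bhKStepSh)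
open Summit.QuantumFields.BalabanUV.Beta.WardLocusQuarticTable (lock_succ_of_pin)
open Summit.QuantumFields.BalabanUV.Beta.WardLocusSymSockets (colM_Gsym_ward Gsym_inr_inr_off divV_dM_SpureSymOf_eq_conjV)
open Summit.QuantumFields.BalabanUV.Beta.WardLocusRecursiveLettersSlot (exists_kernelLaws_of_letters_slot)

namespace Summit.QuantumFields.BalabanUV.Beta.WardLocusSymSecondOrder

section Literal

variable {d Lc : ℕ} [NeZero Lc]

/-- [folklore] **THE SECOND-ORDER WARD KERNEL LAW OF THE LITERAL's W-TABLES `WsymOf tabs` AT EVERY LEVEL, FROM TABLE LETTERS** (generic `d`; pins of record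
`(cE, cVH) = (Lc^{d+1}, −Lc^{d+1}·½·Lc^{d+1})`, `cE₂ = Lc^{2(d+1)}`; root `ρ_c`, generator `X y = diagK (½ • Σ_v legInd ρ_c (Lc•y+v))`).  Every resolvent socket of the
slot-generic chain is DISCHARGED at (`Gsym`, `bhKStepSh d Lc Dsh`, `symEc Lc`) by the tree theorems listed in the module docstring.  DISPLAYED: (Dspr)(Dnull)(V-d) of
the shift `Dsh`; (c1); the row parities (Sp)(Mp); the table letters (T2-W)(T2-B)(T2-M₂) with their remainders' classes and parities.  CONCLUSION: a residual family
`Nr` (uniform vertex-family class, parity-odd rows) with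
`∀ j y ν y′, divW (WsymOf tabs … j) y ν y′ = conjV (dM (Gsym Lc j) Lc (SpureSymOf tabs … j) (tabs.M j) ν y′) (X y) + Nr j y ν y′`. -/
theorem exists_kernelLaws_WsymOf_of_letters (tabs : SymTables d Lc)
    -- the shift of record and its first-order letters
    {Dsh : MKer (d + 1) (Fib d)} (hDs : Spr Dsh) (hDnull : comp (comp (symEc Lc) Dsh) (symEc Lc) = 0)
    (hVd : ∀ u : Fin (d + 1) → ℤ, conjV (bhK Lc + Dsh) (diagK (legInd (ctr (d + 1) Lc) u)) =
      conjV (ffK (bhK (d := d) Lc)) (diagK (legInd (ctr (d + 1) Lc) u)) - ((Lc : ℝ) ^ (d + 1)) • divV tabs.V u)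
    (cΛ cB : ℝ) {cE₂ : ℝ} (hcE₂ : cE₂ = (Lc : ℝ) ^ (2 * (d + 1))) (T : Fin 4 → Fin 4 → Fin 4 → Fin 4 → ℝ)
    -- (c1) the order-one consistency of the multiplier table with the Λ-sector, every level
    (hc1 : ∀ (j : ℕ) (κ : Fin (d + 1)) (u : Fin (d + 1) → ℤ),
      dM (Gsym Lc j) Lc (SpureSymOf tabs ((Lc : ℝ) ^ (d + 1)) (-((Lc : ℝ) ^ (d + 1) * (1 / 2) * (Lc : ℝ) ^ (d + 1))) cΛ j) (tabs.M j) κ u = vertexOfK (Gsym Lc j) Lc (SsymOf tabs ((Lc : ℝ) ^ (d + 1)) (-((Lc : ℝ) ^ (d + 1) * (1 / 2) * (Lc : ℝ) ^ (d + 1))) cΛ j) κ u)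
    -- (Sp)(Mp) the row parities of the first-order tables
    (hSp : ∀ (j : ℕ) (κ : Fin (d + 1)) (u : Fin (d + 1) → ℤ), trK (SpureSymOf tabs ((Lc : ℝ) ^ (d + 1)) (-((Lc : ℝ) ^ (d + 1) * (1 / 2) * (Lc : ℝ) ^ (d + 1))) cΛ j κ u) = -sgnK (SpureSymOf tabs ((Lc : ℝ) ^ (d + 1)) (-((Lc : ℝ) ^ (d + 1) * (1 / 2) * (Lc : ℝ) ^ (d + 1))) cΛ j κ u))
    (hMp : ∀ (j : ℕ) (ρ : Fin (d + 1)) (w : Fin (d + 1) → ℤ), trK (tabs.M j ρ w) = -sgnK (tabs.M j ρ w))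
    -- the LETTERS' remainders, their classes (one rate per level) and row parities
    {RW RW'' : (Fin (d + 1) → ℤ) → Fin (d + 1) → (Fin (d + 1) → ℤ) → MKer (d + 1) (Fib d)}
    {RB RB'' : ℕ → (Fin (d + 1) → ℤ) → Fin (d + 1) → (Fin (d + 1) → ℤ) → MKer (d + 1) (Fib d)}
    {RM : ℕ → (Fin (d + 1) → ℤ) → Fin (d + 1) → (Fin (d + 1) → ℤ) → MKer (d + 1) (Fib d)}
    (hcls0 : ∃ C δ : ℝ, 0 < δ ∧ (∀ Y, LocStencil (RW Y) C δ) ∧ (∀ Y, LocStencil (RW'' Y) C δ) ∧ (∀ Y, LocStencil (RB 0 Y) C δ) ∧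
      (∀ Y, LocStencil (RB'' 0 Y) C δ) ∧ (∀ y, VertexFamily (RM 0 y) Lc C δ))
    (hclsS : ∀ j : ℕ, ∃ C δ : ℝ, 0 < δ ∧ (∀ Y, LocStencil (RB (j + 1) Y) C δ) ∧ (∀ Y, LocStencil (RB'' (j + 1) Y) C δ) ∧
      (∀ y, VertexFamily (RM (j + 1) y) Lc C δ))
    (hRWp : ∀ Y κ u, trK (RW Y κ u) = -sgnK (RW Y κ u)) (hRW''p : ∀ Y κ u, trK (RW'' Y κ u) = -sgnK (RW'' Y κ u))
    (hRBp : ∀ j Y κ u, trK (RB j Y κ u) = -sgnK (RB j Y κ u)) (hRB''p : ∀ j Y κ u, trK (RB'' j Y κ u) = -sgnK (RB'' j Y κ u))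
    (hRMp : ∀ j y ρ' w, trK (RM j y ρ' w) = -sgnK (RM j y ρ' w))
    -- (T2-W) the level-0 Wilson Ward law, both slots
    (hWil : ∀ (Y : Fin (d + 1) → ℤ) (κ' : Fin (d + 1)) (u' : Fin (d + 1) → ℤ),
      (stepScale d Lc 0 * (Lc : ℝ) ^ (d + 1))⁻¹ • ∑ v ∈ box (d + 1) Lc, divV (fun κ u => cE₂ • wilsonW₂ d T κ u κ' u') ((Lc : ℤ) • Y + toSite v) =
        comp (((Lc : ℝ) ^ (d + 1)) • wilsonA d κ' u') (diagK ((1 / 2 : ℝ) • ∑ v ∈ box (d + 1) Lc, legInd (ctr (d + 1) Lc) ((Lc : ℤ) • Y + toSite v)))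
          - comp (diagK ((1 / 2 : ℝ) • ∑ v ∈ box (d + 1) Lc, legInd (ctr (d + 1) Lc) ((Lc : ℤ) • Y + toSite v))) (((Lc : ℝ) ^ (d + 1)) • wilsonA d κ' u') + RW Y κ' u')
    (hWil'' : ∀ (Y : Fin (d + 1) → ℤ) (κ : Fin (d + 1)) (u : Fin (d + 1) → ℤ),
      (stepScale d Lc 0 * (Lc : ℝ) ^ (d + 1))⁻¹ • ∑ v ∈ box (d + 1) Lc, divV (fun κ' u' => cE₂ • wilsonW₂ d T κ u κ' u') ((Lc : ℤ) • Y + toSite v) =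
        comp (((Lc : ℝ) ^ (d + 1)) • wilsonA d κ u) (diagK ((1 / 2 : ℝ) • ∑ v ∈ box (d + 1) Lc, legInd (ctr (d + 1) Lc) ((Lc : ℤ) • Y + toSite v)))
          - comp (diagK ((1 / 2 : ℝ) • ∑ v ∈ box (d + 1) Lc, legInd (ctr (d + 1) Lc) ((Lc : ℤ) • Y + toSite v))) (((Lc : ℝ) ^ (d + 1)) • wilsonA d κ u) + RW'' Y κ u)
    -- (T2-B) the border Ward law of `tabs.vh₂S` against `tabs.V`, both slots, level 0 and level j+1
    (hBord0 : ∀ (Y : Fin (d + 1) → ℤ) (κ' : Fin (d + 1)) (u' : Fin (d + 1) → ℤ),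
      (stepScale d Lc 0 * (Lc : ℝ) ^ (d + 1))⁻¹ • ∑ v ∈ box (d + 1) Lc, divV (fun κ u => cB • tabs.vh₂S κ u κ' u') ((Lc : ℤ) • Y + toSite v) =
        comp ((-((Lc : ℝ) ^ (d + 1) * (1 / 2) * (Lc : ℝ) ^ (d + 1))) • tabs.V κ' u') (diagK ((1 / 2 : ℝ) • ∑ v ∈ box (d + 1) Lc, legInd (ctr (d + 1) Lc) ((Lc : ℤ) • Y + toSite v)))
          - comp (diagK ((1 / 2 : ℝ) • ∑ v ∈ box (d + 1) Lc, legInd (ctr (d + 1) Lc) ((Lc : ℤ) • Y + toSite v))) ((-((Lc : ℝ) ^ (d + 1) * (1 / 2) * (Lc : ℝ) ^ (d + 1))) • tabs.V κ' u') + RB 0 Y κ' u')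
    (hBord0'' : ∀ (Y : Fin (d + 1) → ℤ) (κ : Fin (d + 1)) (u : Fin (d + 1) → ℤ),
      (stepScale d Lc 0 * (Lc : ℝ) ^ (d + 1))⁻¹ • ∑ v ∈ box (d + 1) Lc, divV (fun κ' u' => cB • tabs.vh₂S κ u κ' u') ((Lc : ℤ) • Y + toSite v) =
        comp ((-((Lc : ℝ) ^ (d + 1) * (1 / 2) * (Lc : ℝ) ^ (d + 1))) • tabs.V κ u) (diagK ((1 / 2 : ℝ) • ∑ v ∈ box (d + 1) Lc, legInd (ctr (d + 1) Lc) ((Lc : ℤ) • Y + toSite v)))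
          - comp (diagK ((1 / 2 : ℝ) • ∑ v ∈ box (d + 1) Lc, legInd (ctr (d + 1) Lc) ((Lc : ℤ) • Y + toSite v))) ((-((Lc : ℝ) ^ (d + 1) * (1 / 2) * (Lc : ℝ) ^ (d + 1))) • tabs.V κ u) + RB'' 0 Y κ u)
    (hBordS : ∀ (j : ℕ) (Y : Fin (d + 1) → ℤ) (κ' : Fin (d + 1)) (u' : Fin (d + 1) → ℤ),
      (stepScale d Lc (j + 1) * (Lc : ℝ) ^ (d + 1))⁻¹ • ∑ v ∈ box (d + 1) Lc, divV (fun κ u => (cB * wB2 d Lc (j + 1)) • tabs.vh₂S κ u κ' u') ((Lc : ℤ) • Y + toSite v) =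
        comp (((-((Lc : ℝ) ^ (d + 1) * (1 / 2) * (Lc : ℝ) ^ (d + 1))) * wVH d Lc (j + 1)) • tabs.V κ' u') (diagK ((1 / 2 : ℝ) • ∑ v ∈ box (d + 1) Lc, legInd (ctr (d + 1) Lc) ((Lc : ℤ) • Y + toSite v)))
          - comp (diagK ((1 / 2 : ℝ) • ∑ v ∈ box (d + 1) Lc, legInd (ctr (d + 1) Lc) ((Lc : ℤ) • Y + toSite v))) (((-((Lc : ℝ) ^ (d + 1) * (1 / 2) * (Lc : ℝ) ^ (d + 1))) * wVH d Lc (j + 1)) • tabs.V κ' u') + RB (j + 1) Y κ' u')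
    (hBordS'' : ∀ (j : ℕ) (Y : Fin (d + 1) → ℤ) (κ : Fin (d + 1)) (u : Fin (d + 1) → ℤ),
      (stepScale d Lc (j + 1) * (Lc : ℝ) ^ (d + 1))⁻¹ • ∑ v ∈ box (d + 1) Lc, divV (fun κ' u' => (cB * wB2 d Lc (j + 1)) • tabs.vh₂S κ u κ' u') ((Lc : ℤ) • Y + toSite v) =
        comp (((-((Lc : ℝ) ^ (d + 1) * (1 / 2) * (Lc : ℝ) ^ (d + 1))) * wVH d Lc (j + 1)) • tabs.V κ u) (diagK ((1 / 2 : ℝ) • ∑ v ∈ box (d + 1) Lc, legInd (ctr (d + 1) Lc) ((Lc : ℤ) • Y + toSite v)))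
          - comp (diagK ((1 / 2 : ℝ) • ∑ v ∈ box (d + 1) Lc, legInd (ctr (d + 1) Lc) ((Lc : ℤ) • Y + toSite v))) (((-((Lc : ℝ) ^ (d + 1) * (1 / 2) * (Lc : ℝ) ^ (d + 1))) * wVH d Lc (j + 1)) • tabs.V κ u) + RB'' (j + 1) Y κ u)
    -- (T2-M₂) the mixed Ward law of `M2Of tabs.mixFF j` against `tabs.M j`, every level
    (hM₂ : ∀ (j : ℕ) (y : Fin (d + 1) → ℤ) (ρ' : Fin (d + 1)) (w : Fin (d + 1) → ℤ),
      (stepScale d Lc j * (Lc : ℝ) ^ (d + 1))⁻¹ • ∑ v ∈ box (d + 1) Lc, divV (fun κ u => M2Of d Lc tabs.mixFF j κ u ρ' w) ((Lc : ℤ) • y + toSite v) =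
        comp (tabs.M j ρ' w) (diagK ((1 / 2 : ℝ) • ∑ v ∈ box (d + 1) Lc, legInd (ctr (d + 1) Lc) ((Lc : ℤ) • y + toSite v))) - comp (diagK ((1 / 2 : ℝ) • ∑ v ∈ box (d + 1) Lc, legInd (ctr (d + 1) Lc) ((Lc : ℤ) • y + toSite v))) (tabs.M j ρ' w) + RM j y ρ' w) :
    ∃ Nr : ℕ → (Fin (d + 1) → ℤ) → Fin (d + 1) → (Fin (d + 1) → ℤ) → MKer (d + 1) (Fib d),
      (∀ j, ∃ C δ : ℝ, 0 < δ ∧ ∀ y, VertexFamily (Nr j y) Lc C δ) ∧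
      (∀ j y ν y', trK (Nr j y ν y') = -sgnK (Nr j y ν y')) ∧
      (∀ (j : ℕ) (y : Fin (d + 1) → ℤ) (ν : Fin (d + 1)) (y' : Fin (d + 1) → ℤ),
        divW (WsymOf tabs ((Lc : ℝ) ^ (d + 1)) (-((Lc : ℝ) ^ (d + 1) * (1 / 2) * (Lc : ℝ) ^ (d + 1))) cΛ cE₂ cB T j) y ν y' =
          conjV (dM (Gsym Lc j) Lc (SpureSymOf tabs ((Lc : ℝ) ^ (d + 1)) (-((Lc : ℝ) ^ (d + 1) * (1 / 2) * (Lc : ℝ) ^ (d + 1))) cΛ j) (tabs.M j) ν y') (diagK ((1 / 2 : ℝ) • ∑ v ∈ box (d + 1) Lc, legInd (ctr (d + 1) Lc) ((Lc : ℤ) • y + toSite v))) + Nr j y ν y') := by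
  have hLc : 1 ≤ Lc := one_le_of_neZero Lc
  have hr : ctrOff (d + 1) Lc ∈ box (d + 1) Lc := ctrOff_mem_box hLc
  have hGt : ∀ j : ℕ, trK (Gsym (d := d) Lc j) = sgnK (Gsym (d := d) Lc j) := fun j => by
    rw [Gsym_apply]
    exact trK_coDressKSymAt_KInvStep (d := d) hr j
  simp only [WsymOf_eq]
  exact exists_kernelLaws_of_letters_slot (V := tabs.V) (H := tabs.H) (G := Gsym Lc) (M := tabs.M) hLc tabs.hV tabs.hH (decays_Gsym Lc) tabs.hM
    _ _ cΛ cE₂ cB T tabs.hB tabs.hmix (fun j => bhKStepSh d Lc Dsh j) (spr_bhKStepSh hDs) (symEc Lc) (spr_symEc hLc)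
    (fun j => relInv_Gsym_bhKStep_add (d := d) (Lc := Lc) j hDs hDnull (stepScale d Lc j))
    (fun j => (stepScale d Lc j * (Lc : ℝ) ^ (d + 1))⁻¹) (fun j y κ' u => colH_ward_coDressKSymAt_KInvStep (d := d) (Lc := Lc) j y κ' u)
    (fun j y ρ w => colM_Gsym_ward (d := d) (Lc := Lc) j y ρ w) (fun j x hx z ρ μ => Gsym_inr_inr_off (d := d) (Lc := Lc) j x hx z ρ μ) hr (1 / 2 : ℝ)
    (fun y => comp_symEc_blockGen_comm hLc _ (1 / 2 : ℝ) y) (fun j y => divV_dM_SpureSymOf_eq_conjV tabs hDs hDnull hVd cΛ j y) hc1 hGt hSp hMp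
    (fun j => lock_succ_of_pin (d := d) hLc hcE₂ j) hcls0 hclsS hRWp hRW''p hRBp hRB''p hRMp hWil hWil'' hBord0 hBord0'' hBordS hBordS'' hM₂

end Literal

end Summit.QuantumFields.BalabanUV.Beta.WardLocusSymSecondOrder

end
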